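import Literature.NumberTheory.Automorphic.UnitaryGroupTraceClasses
import Literature.NumberTheory.Automorphic.AutomorphicQuotientKernelGeometric
import Literature.NumberTheory.Automorphic.AutomorphicQuotientKernelConvolution
import HarnessLib

/-!
# The geometric side of the trace formula for an anisotropic group, and for the unitary group
`U(H)` of a CM field: `∫_X K_Φ(x, x) dμ = κ Σ_{[γ]} d_{[γ]} ∫_{G(𝔸) ⧸ G_γ} Φ(y γ y⁻¹) dμ_γ(y)`
(Rogawski, *Automorphic representations of unitary groups in three variables* (1990), §14.5
p. 237 (print); Gelbart (1975), (9.13); Deitmar–Echterhoff (2014), Thm. 9.3.2)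

Topic `NumberTheory/Automorphic`; namespace `Literature.NumberTheory.Automorphic` (grouping
sub-namespaces `AdelicGroupData`, `UnitaryGroup`). Proof file: theorems only, no definition, no named
fact, no `sorry`; imports = tree + Mathlib.

Assembly of the tree's generic geometric side `AdelicGroupData.integral_quotientKernel_diag_eq_mul_tsum`
(`AutomorphicQuotientKernelGeometric`; Gelbart (1975), (9.13)) with the per-class inputs of
`UnitaryGroupTraceClasses` (compact centraliser quotients, unimodularity, orbital measures) for an
adelic group datum with **`A_G = ⊥`, discrete `G(K)` and compact automorphic quotient**, and for the
unitary group of an ANISOTROPIC hermitian matrix over a CM field (`UnitaryGroup.cmDatum L N H`) —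
Rogawski's inner form `G′ = U(V)`, `D = M₃(E)`: "since `G′` is anisotropic, `T_{G′}(f′)` is the
trace of `ρ(f′)` on `L(G′)`" and is given by its `O`-expansion [Rogawski1990, §14.5 p. 237 (print)].

* `AdelicGroupData.integral_quotientKernel_diag_eq_mul_tsum_of_center'_eq_bot` — for `A_G = ⊥`
  (the central integral `Φ_A = ∫_{A_G} Φ(a⁻¹ ·) dα` is `Φ` itself for the probability Haar measure
  on the trivial `A_G`): there are `κ > 0`, `d_{[γ]} ∈ (0, ∞)` and non-zero invariant measures
  `μ_{[γ]}` on `G(𝔸) ⧸ G_γ` (`γ` running over representatives of the conjugacy classes of `G(K)`,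
  `G_γ = C_{G(𝔸)}(γ)`) such that for every `Φ ∈ C_c(G(𝔸))` every orbital integral
  `O_γ(Φ) = ∫ Φ(y γ y⁻¹) dμ_{[γ]}` converges absolutely, `Σ_{[γ]} d_{[γ]} ∫ |Φ(y γ y⁻¹)| < ∞`, and
  `∫_X K_Φ(x, x) dμ = κ Σ'_{[γ]} d_{[γ]} O_γ(Φ)`;
* `UnitaryGroup.integral_quotientKernel_diag_eq_mul_tsum_cmDatum` — the same for `U(H)`, `H`
  anisotropic (every `N`);
* `UnitaryGroup.hasSum_norm_sq_integratedOperator_eq_tsum_orbital_cmDatum` — combined with the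
  spectral side in Hilbert–Schmidt form (`hasSum_norm_sq_integratedOperator_rightRegular_eq_diagonal`,
  Gelbart's Lemma 10.6 currency, the one of the floor-0 line `F0_T1InnerFormTraceIdentity`):
  **`Σ_i ‖R(f) e_i‖² = c⁻¹ κ Σ'_{[γ]} d_{[γ]} O_γ(f ⋆ f^*)`** for every `f ∈ C_c(U(H)(𝔸))` and every
  countable Hilbert basis `(e_i)` of `L²(U(H)(L⁺) \ U(H)(𝔸), μ)` — the concrete `J_{G′}`-side of the
  simple trace formula for the inner form;
  `UnitaryGroup.hasSum_norm_sq_integratedOperator_eq_const_mul_tsum_orbital_cmDatum` — the same with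
  ONE constant `C = c⁻¹ κ > 0` and `ρ = haar` chosen inside, so that the STATEMENT needs only the
  line's data `(μ, ν)` and no quotient-form instances.

Instances: the kernel-form statements use the tree's quotient-form local instances
(`AdelicGroupData.measurableSpaceQuotientForm` …, as in `AutomorphicQuotientKernelGeometric` and
`QuaternionUnitsTraceClasses`), which ARE the instances of `𝒢.automorphicQuotient` keyed on the
syntactic form `G(𝔸) ⧸ A_G G(K)`; nothing is overridden.

CAVEAT (constants, inherited): `κ`, `c = unfoldingConstant` and the `d_{[γ]}` are positive reals NOT
identified with the Tamagawa-type volumes `a_γ = vol(G(K)_γ \ G_γ(𝔸))` of the printed formula, and the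
`μ_{[γ]}` are not normalised. What is deliberately NOT here: grouping of the classes into stable
classes, multiplicities `m(π)` (spectral bookkeeping beyond the Hilbert–Schmidt form), test functions
finer than `C_c`.

## References

* J. D. Rogawski, *Automorphic Representations of Unitary Groups in Three Variables*, Ann. of Math.
  Stud. 123 (1990), §14.5 p. 237 (print) [Rogawski1990].
* S. Gelbart, *Automorphic forms on adele groups*, Ann. of Math. Stud. 83 (1975), (9.13), Remark 9.23,
  Lemma 10.6 [Gelbart1975].
* A. Deitmar, S. Echterhoff, *Principles of Harmonic Analysis*, 2nd ed. (2014), Thm. 9.3.2,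
  Lemma 9.3.3 [DeitmarEchterhoff2014].
-/

noncomputable section

open MeasureTheory Measure Set Filter Topology NumberField CompactlySupported
open Literature.MeasureTheory.Group
open scoped ENNReal NNReal Pointwise

namespace Literature.NumberTheory.Automorphic

universe u

/-- The centraliser of an element of a Hausdorff topological group is closed. [folklore] -/
private theorem isClosed_centralizer_singleton'' {G : Type*} [Group G] [TopologicalSpace G]
    [IsTopologicalGroup G] [T2Space G] (γ : G) :
    IsClosed ((Subgroup.centralizer ({γ} : Set G) : Subgroup G) : Set G) := by
  have h : ((Subgroup.centralizer ({γ} : Set G) : Subgroup G) : Set G) =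
      {g : G | γ * g = g * γ} := by
    ext g
    rw [SetLike.mem_coe, Subgroup.mem_centralizer_iff]
    simp only [Set.mem_singleton_iff, forall_eq, Set.mem_setOf_eq]
  rw [h]
  exact isClosed_eq (continuous_const.mul continuous_id) (continuous_id.mul continuous_const)

namespace AdelicGroupData

variable {K : Type} [Field K] [NumberField K] (𝒢 : AdelicGroupData.{u} K)

/-- For `A_G = ⊥` the trivial homomorphism is a continuous central retraction (values in `A_G`,
the identity on `A_G`, trivial on `G(K)`), cf. `exists_isAutomorphicMeasure_of_center'_eq_bot`.
[folklore] -/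
private theorem centralRetraction_one (hc : 𝒢.center' = ⊥) :
    Continuous (1 : 𝒢.Adelic →* 𝒢.Adelic) ∧ (∀ g, (1 : 𝒢.Adelic →* 𝒢.Adelic) g ∈ 𝒢.center') ∧
      (∀ a ∈ 𝒢.center', (1 : 𝒢.Adelic →* 𝒢.Adelic) a = a) ∧
      ∀ γ ∈ 𝒢.arithmeticSubgroup, (1 : 𝒢.Adelic →* 𝒢.Adelic) γ = 1 := by
  refine ⟨continuous_const, fun g => ?_, fun a ha => ?_, fun γ _ => rfl⟩
  · rw [MonoidHom.one_apply]
    exact one_mem _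
  · rw [hc, Subgroup.mem_bot] at ha
    rw [ha, MonoidHom.one_apply]

attribute [local instance] measurableSpaceQuotientForm borelSpaceQuotientForm
  smulInvariantMeasureQuotientForm isFiniteMeasureOnCompactsQuotientForm isFiniteMeasureQuotientForm

variable [LocallyCompactSpace 𝒢.Adelic] [SecondCountableTopology 𝒢.Adelic] [T2Space 𝒢.Adelic]
  [MeasurableSpace 𝒢.Adelic] [BorelSpace 𝒢.Adelic]
  [∀ γ : 𝒢.Adelic, MeasurableSpace (𝒢.Adelic ⧸ Subgroup.centralizer ({γ} : Set 𝒢.Adelic))]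
  [∀ γ : 𝒢.Adelic, BorelSpace (𝒢.Adelic ⧸ Subgroup.centralizer ({γ} : Set 𝒢.Adelic))]

/-- **The geometric side of the trace formula for a datum with trivial split centre and compact
automorphic quotient** (Gelbart (1975), (9.13): `tr R₀(φ) = Σ_{[γ]} vol(Γ(γ)\G_γ) ∫_{G_γ\G} φ(x⁻¹γx) dx`;
Deitmar–Echterhoff (2014), Thm. 9.3.2 for a uniform lattice). Let `𝒢` be an adelic group datum with
`A_G = ⊥`, `G(𝔸_K)` locally compact second countable Hausdorff, `G(K)` discrete and
`X = G(𝔸_K) ⧸ G(K)` compact; `μ` an automorphic measure on `X`, `ρ` a Haar measure on the (discrete)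
group `A_G · G(K) = G(K)` (the binders `[IsClosed …]`, `[ρ.IsMulRightInvariant]`, `[SFinite ρ]` are
those under which the kernel `quotientKernel` is stated; right invariance HOLDS here, by the tree's
`isMulRightInvariant_of_centralRetraction` with `θ = 1`). Then there are a constant `κ > 0`, constants `d_c ∈ (0, ∞)` and non-zero
`G(𝔸_K)`-invariant Borel measures `μ_c` finite on compact sets on `G(𝔸_K) ⧸ G_{γ_c}`, indexed by the
conjugacy classes `c` of `G(K)` with representatives `γ_c = out c` and `G_{γ_c} = C_{G(𝔸_K)}(γ_c)`,
such that for every `Φ ∈ C_c(G(𝔸_K))`: every orbital integrand `y ↦ Φ(y γ_c y⁻¹)` is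
`μ_c`-integrable, `Σ_c d_c ∫ |Φ(y γ_c y⁻¹)| dμ_c < ∞`, and

  `∫_X K_Φ(x, x) dμ(x) = κ Σ'_c d_c ∫_{G(𝔸_K) ⧸ G_{γ_c}} Φ(y γ_c y⁻¹) dμ_c(y)`.

All per-class inputs are PROVED (`UnitaryGroupTraceClasses`: `compactSpace_centralizer_quotient`,
`exists_smulInvariantMeasure_quotient_[inf_]centralizer_of_center'_eq_bot`; the trivial central
retraction; `Φ_A = Φ` for the probability Haar measure on `A_G = 1`), the assembly being
`integral_quotientKernel_diag_eq_mul_tsum`. CAVEAT: `κ`, `d_c`, `μ_c` are not normalised.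
[cite: Gelbart1975, (9.13) and Remark 9.23] -/
theorem integral_quotientKernel_diag_eq_mul_tsum_of_center'_eq_bot (hc : 𝒢.center' = ⊥)
    (hdisc : 𝒢.IsDiscreteRational) [CompactSpace 𝒢.automorphicQuotient]
    [hH : IsClosed (𝒢.quotientSubgroup : Set 𝒢.Adelic)]
    (μ : Measure 𝒢.automorphicQuotient) [𝒢.IsAutomorphicMeasure μ]
    (ρ : Measure 𝒢.quotientSubgroup) [ρ.IsHaarMeasure] [ρ.IsMulRightInvariant] [SFinite ρ] :
    ∃ (κ : ℝ≥0) (dc : ConjClasses 𝒢.arithmeticSubgroup → ℝ≥0∞)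
      (μC : ∀ c : ConjClasses 𝒢.arithmeticSubgroup, Measure (𝒢.Adelic ⧸
        Subgroup.centralizer ({((Quotient.out c : 𝒢.arithmeticSubgroup) : 𝒢.Adelic)} :
          Set 𝒢.Adelic))),
      0 < κ ∧ (∀ c, dc c ≠ 0 ∧ dc c ≠ ∞) ∧
      (∀ c, SMulInvariantMeasure 𝒢.Adelic _ (μC c) ∧ IsFiniteMeasureOnCompacts (μC c) ∧
        μC c ≠ 0) ∧
      ∀ Φ : C_c(𝒢.Adelic, ℂ),
        (∀ c, Integrable (descConj ((Quotient.out c : 𝒢.arithmeticSubgroup) : 𝒢.Adelic)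
          (Subgroup.centralizer ({((Quotient.out c : 𝒢.arithmeticSubgroup) : 𝒢.Adelic)} :
            Set 𝒢.Adelic)) (fun _ hg => Subgroup.mem_centralizer_singleton_iff.1 hg) Φ) (μC c)) ∧
        Summable (fun c => (dc c).toReal * ∫ y, ‖descConj
          ((Quotient.out c : 𝒢.arithmeticSubgroup) : 𝒢.Adelic)
          (Subgroup.centralizer ({((Quotient.out c : 𝒢.arithmeticSubgroup) : 𝒢.Adelic)} :
            Set 𝒢.Adelic)) (fun _ hg => Subgroup.mem_centralizer_singleton_iff.1 hg) Φ y‖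
              ∂(μC c)) ∧
        ∫ x, quotientKernel 𝒢.quotientSubgroup ρ Φ x x ∂μ =
          ((κ : ℝ) : ℂ) * ∑' c, ((dc c).toReal : ℂ) * ∫ y, descConj
            ((Quotient.out c : 𝒢.arithmeticSubgroup) : 𝒢.Adelic)
            (Subgroup.centralizer ({((Quotient.out c : 𝒢.arithmeticSubgroup) : 𝒢.Adelic)} :
              Set 𝒢.Adelic)) (fun _ hg => Subgroup.mem_centralizer_singleton_iff.1 hg) Φ y
                ∂(μC c) := by
  classical
  haveI : DiscreteTopology 𝒢.arithmeticSubgroup := hdisc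
  haveI : Countable 𝒢.arithmeticSubgroup := DiscreteSubgroup.countable_of_discrete _
  obtain ⟨hθc, hθA, hθa, hθγ⟩ := 𝒢.centralRetraction_one hc
  have hρ0 : ρ ≠ 0 := fun h => by
    have h2 : 0 < ρ Set.univ := isOpen_univ.measure_pos ρ ⟨1, trivial⟩
    rw [h] at h2
    exact lt_irrefl _ h2
  -- `A_G = 1`: a point; its probability Haar measure `α`, for which `Φ_A = Φ`
  have hsub : ∀ a : 𝒢.center', (a : 𝒢.Adelic) = 1 := fun a =>
    Subgroup.mem_bot.1 (by rw [← hc]; exact a.2)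
  haveI : Subsingleton 𝒢.center' := ⟨fun a b => Subtype.ext ((hsub a).trans (hsub b).symm)⟩
  haveI : CompactSpace 𝒢.center' := Finite.compactSpace
  have hAc : IsClosed (𝒢.center' : Set 𝒢.Adelic) := by
    rw [hc, Subgroup.coe_bot]
    exact isClosed_singleton
  haveI : LocallyCompactSpace 𝒢.center' := hAc.isClosedEmbedding_subtypeVal.locallyCompactSpace
  obtain ⟨α, hαH, hα1⟩ : ∃ α : Measure 𝒢.center', α.IsHaarMeasure ∧ α Set.univ = 1 := by
    have h0 : (haar : Measure 𝒢.center') Set.univ ≠ 0 :=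
      (isOpen_univ.measure_pos haar ⟨1, trivial⟩).ne'
    have htop : (haar : Measure 𝒢.center') Set.univ ≠ ∞ :=
      (isCompact_univ.measure_lt_top (μ := (haar : Measure 𝒢.center'))).ne
    refine ⟨((haar : Measure 𝒢.center') Set.univ)⁻¹ • haar,
      IsHaarMeasure.smul (haar : Measure 𝒢.center') (ENNReal.inv_ne_zero.2 htop)
        (ENNReal.inv_ne_top.2 h0), ?_⟩
    rw [Measure.smul_apply, smul_eq_mul, ENNReal.inv_mul_cancel h0 htop]
  haveI := hαH
  haveI : IsFiniteMeasure α := ⟨by rw [hα1]; exact ENNReal.one_lt_top⟩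
  have hΦA : ∀ Φ : C_c(𝒢.Adelic, ℂ),
      (fun g => ∫ a, Φ ((a : 𝒢.Adelic)⁻¹ * g) ∂α) = ⇑Φ := by
    intro Φ
    funext g
    have h1 : (fun a : 𝒢.center' => Φ ((a : 𝒢.Adelic)⁻¹ * g)) = fun _ => Φ g := by
      funext a
      rw [hsub a, inv_one, one_mul]
    rw [h1, integral_const]
    simp [measureReal_def, hα1]
  -- `ρ = κ • (α ⊗ counting)`
  obtain ⟨κ, hκpos, hκ⟩ := exists_eq_smul_map_mul_prod_count 𝒢 hdisc 1 hθc hθA hθa hθγ α ρ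
  -- representatives and the per-class data
  have hrep : ∀ c : ConjClasses 𝒢.arithmeticSubgroup,
      ConjClasses.mk (Quotient.out c : 𝒢.arithmeticSubgroup) = c := fun c => by
    rw [← ConjClasses.quotient_mk_eq_mk]
    exact Quotient.out_eq c
  have hexC := fun c : ConjClasses 𝒢.arithmeticSubgroup =>
    𝒢.exists_smulInvariantMeasure_quotient_centralizer_of_center'_eq_bot hc hdisc
      (γ := ((Quotient.out c : 𝒢.arithmeticSubgroup) : 𝒢.Adelic)) (Quotient.out c).2
  choose μC hμCinv hμCfin hμC0 using hexC
  letI : ∀ c : ConjClasses 𝒢.arithmeticSubgroup, MeasurableSpace (𝒢.Adelic ⧸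
      (𝒢.quotientSubgroup ⊓ Subgroup.centralizer
        ({((Quotient.out c : 𝒢.arithmeticSubgroup) : 𝒢.Adelic)} : Set 𝒢.Adelic))) :=
    fun c => borel _
  haveI : ∀ c : ConjClasses 𝒢.arithmeticSubgroup, BorelSpace (𝒢.Adelic ⧸
      (𝒢.quotientSubgroup ⊓ Subgroup.centralizer
        ({((Quotient.out c : 𝒢.arithmeticSubgroup) : 𝒢.Adelic)} : Set 𝒢.Adelic))) :=
    fun c => ⟨rfl⟩
  have hexH := fun c : ConjClasses 𝒢.arithmeticSubgroup =>
    𝒢.exists_smulInvariantMeasure_quotient_inf_centralizer_of_center'_eq_bot hc hdisc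
      ((Quotient.out c : 𝒢.arithmeticSubgroup) : 𝒢.Adelic)
  choose μH hμHinv hμHfin hμH0 using hexH
  haveI : ∀ c, SMulInvariantMeasure 𝒢.Adelic _ (μC c) := hμCinv
  haveI : ∀ c, IsFiniteMeasureOnCompacts (μC c) := hμCfin
  haveI : ∀ c, SMulInvariantMeasure 𝒢.Adelic _ (μH c) := hμHinv
  haveI : ∀ c, IsFiniteMeasureOnCompacts (μH c) := hμHfin
  haveI : ∀ c : ConjClasses 𝒢.arithmeticSubgroup,
      IsClosed ((Subgroup.centralizer ({((Quotient.out c : 𝒢.arithmeticSubgroup) :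
        𝒢.Adelic)} : Set 𝒢.Adelic) : Subgroup 𝒢.Adelic) : Set 𝒢.Adelic) := fun c =>
    isClosed_centralizer_singleton'' _
  haveI : ∀ c : ConjClasses 𝒢.arithmeticSubgroup,
      CompactSpace (↥(Subgroup.centralizer ({((Quotient.out c : 𝒢.arithmeticSubgroup) :
        𝒢.Adelic)} : Set 𝒢.Adelic)) ⧸ (𝒢.quotientSubgroup ⊓
        Subgroup.centralizer ({((Quotient.out c : 𝒢.arithmeticSubgroup) : 𝒢.Adelic)} :
          Set 𝒢.Adelic)).subgroupOf (Subgroup.centralizer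
            ({((Quotient.out c : 𝒢.arithmeticSubgroup) : 𝒢.Adelic)} : Set 𝒢.Adelic))) :=
    fun c => 𝒢.compactSpace_centralizer_quotient hdisc (Quotient.out c).2
  obtain ⟨dc, hdc, hId⟩ := exists_lintegral_conjTsum_eq_tsum 𝒢 hdisc 1 hθc hθA hθa hθγ
    (fun c => Quotient.out c) hrep
    (fun c => Subgroup.centralizer ({((Quotient.out c : 𝒢.arithmeticSubgroup) : 𝒢.Adelic)} :
      Set 𝒢.Adelic))
    (fun c => inf_le_right) (fun c => fun _ hg => Subgroup.mem_centralizer_singleton_iff.1 hg)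
    μ μH μC hμH0 hμC0
  refine ⟨κ, dc, μC, hκpos, hdc, fun c => ⟨hμCinv c, hμCfin c, hμC0 c⟩, fun Φ => ?_⟩
  obtain ⟨hInt, hSum, hEq⟩ := integral_quotientKernel_diag_eq_mul_tsum 𝒢 hdisc 1 hθc hθA hθa
    hθγ α ρ hκ (fun c => Quotient.out c)
    (fun c => Subgroup.centralizer ({((Quotient.out c : 𝒢.arithmeticSubgroup) : 𝒢.Adelic)} :
      Set 𝒢.Adelic))
    (fun c => fun _ hg => Subgroup.mem_centralizer_singleton_iff.1 hg) μ μC hρ0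
    (fun c => (hdc c).1) hId Φ
  -- `Φ_A = Φ`
  have hdesc : ∀ c : ConjClasses 𝒢.arithmeticSubgroup,
      descConj ((Quotient.out c : 𝒢.arithmeticSubgroup) : 𝒢.Adelic)
        (Subgroup.centralizer ({((Quotient.out c : 𝒢.arithmeticSubgroup) : 𝒢.Adelic)} :
          Set 𝒢.Adelic)) (fun _ hg => Subgroup.mem_centralizer_singleton_iff.1 hg)
        (fun g => ∫ a, Φ ((a : 𝒢.Adelic)⁻¹ * g) ∂α) =
      descConj ((Quotient.out c : 𝒢.arithmeticSubgroup) : 𝒢.Adelic)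
        (Subgroup.centralizer ({((Quotient.out c : 𝒢.arithmeticSubgroup) : 𝒢.Adelic)} :
          Set 𝒢.Adelic)) (fun _ hg => Subgroup.mem_centralizer_singleton_iff.1 hg) ⇑Φ :=
    fun c => congrArg (descConj ((Quotient.out c : 𝒢.arithmeticSubgroup) : 𝒢.Adelic)
      (Subgroup.centralizer ({((Quotient.out c : 𝒢.arithmeticSubgroup) : 𝒢.Adelic)} :
        Set 𝒢.Adelic)) (fun _ hg => Subgroup.mem_centralizer_singleton_iff.1 hg)) (hΦA Φ)
  simp only [hdesc] at hInt hSum hEq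
  exact ⟨hInt, hSum, hEq⟩

end AdelicGroupData

/-! ### The unitary group of an anisotropic hermitian matrix over a CM field -/

namespace UnitaryGroup

open Literature.AlgebraicGeometry.ShimuraVarieties (hermForm)

variable (L : Type) [Field L] [NumberField L] [IsCMField L] (N : ℕ) (H : Matrix (Fin N) (Fin N) L)
  [MeasurableSpace (cmDatum L N H).Adelic] [BorelSpace (cmDatum L N H).Adelic]
  [∀ γ : (cmDatum L N H).Adelic, MeasurableSpace ((cmDatum L N H).Adelic ⧸
    Subgroup.centralizer ({γ} : Set (cmDatum L N H).Adelic))]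
  [∀ γ : (cmDatum L N H).Adelic, BorelSpace ((cmDatum L N H).Adelic ⧸
    Subgroup.centralizer ({γ} : Set (cmDatum L N H).Adelic))]

attribute [local instance] AdelicGroupData.measurableSpaceQuotientForm
  AdelicGroupData.borelSpaceQuotientForm AdelicGroupData.smulInvariantMeasureQuotientForm
  AdelicGroupData.isFiniteMeasureOnCompactsQuotientForm AdelicGroupData.isFiniteMeasureQuotientForm

/-- **The geometric side of the trace formula for the unitary group `U(H)` of an ANISOTROPIC
hermitian matrix `H ∈ M_N(L)` over a CM field `L`** (Rogawski (1990), §14.5 p. 237 (print), for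
`N = 3`: "since `G′` is anisotropic, `T_{G′}(f′)` is the trace of `ρ(f′)` on `L(G′)`" — its
`O`-expansion `Σ_{γ} a_γ Φ_γ(f′)`; Gelbart (1975), (9.13)). With `𝒢 = cmDatum L N H`
(`G(𝔸) = U(H)(𝔸_{L⁺})`, `G(K) = U(H)(L⁺)`, `A_G = ⊥`; `X = U(H)(𝔸_{L⁺}) ⧸ U(H)(L⁺)` compact by
Godement's criterion), `μ` automorphic and `ρ` a Haar measure on the discrete `U(H)(L⁺)`: there are
`κ > 0`, `d_c ∈ (0, ∞)` and non-zero invariant measures `μ_c` on `U(H)(𝔸) ⧸ U(H)(𝔸)_{γ_c}` (`c` the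
conjugacy classes of `U(H)(L⁺)`, `γ_c = out c`) with, for every `Φ ∈ C_c(U(H)(𝔸))`, absolutely
convergent orbital integrals `O_{γ_c}(Φ) = ∫ Φ(y γ_c y⁻¹) dμ_c`, `Σ_c d_c O_{γ_c}(|Φ|) < ∞`, and
`∫_X K_Φ(x, x) dμ = κ Σ'_c d_c O_{γ_c}(Φ)` (`AdelicGroupData.integral_quotientKernel_diag_eq_mul_tsum_of_center'_eq_bot`).
CAVEAT: constants and measures not normalised. [cite: Rogawski1990, §14.5 p. 237] -/
theorem integral_quotientKernel_diag_eq_mul_tsum_cmDatum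
    (hanis : ∀ x : Fin N → L, hermForm (cmConjRingHom L) H x x = 0 → x = 0)
    [hH : IsClosed ((cmDatum L N H).quotientSubgroup : Set (cmDatum L N H).Adelic)]
    (μ : Measure (cmDatum L N H).automorphicQuotient) [(cmDatum L N H).IsAutomorphicMeasure μ]
    (ρ : Measure (cmDatum L N H).quotientSubgroup) [ρ.IsHaarMeasure] [ρ.IsMulRightInvariant]
    [SFinite ρ] :
    ∃ (κ : ℝ≥0) (dc : ConjClasses (cmDatum L N H).arithmeticSubgroup → ℝ≥0∞)
      (μC : ∀ c : ConjClasses (cmDatum L N H).arithmeticSubgroup, Measure ((cmDatum L N H).Adelic ⧸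
        Subgroup.centralizer ({((Quotient.out c : (cmDatum L N H).arithmeticSubgroup) :
          (cmDatum L N H).Adelic)} : Set (cmDatum L N H).Adelic))),
      0 < κ ∧ (∀ c, dc c ≠ 0 ∧ dc c ≠ ∞) ∧
      (∀ c, SMulInvariantMeasure (cmDatum L N H).Adelic _ (μC c) ∧
        IsFiniteMeasureOnCompacts (μC c) ∧ μC c ≠ 0) ∧
      ∀ Φ : C_c((cmDatum L N H).Adelic, ℂ),
        (∀ c, Integrable (descConj ((Quotient.out c : (cmDatum L N H).arithmeticSubgroup) :
            (cmDatum L N H).Adelic)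
          (Subgroup.centralizer ({((Quotient.out c : (cmDatum L N H).arithmeticSubgroup) :
            (cmDatum L N H).Adelic)} : Set (cmDatum L N H).Adelic))
          (fun _ hg => Subgroup.mem_centralizer_singleton_iff.1 hg) Φ) (μC c)) ∧
        Summable (fun c => (dc c).toReal * ∫ y, ‖descConj
          ((Quotient.out c : (cmDatum L N H).arithmeticSubgroup) : (cmDatum L N H).Adelic)
          (Subgroup.centralizer ({((Quotient.out c : (cmDatum L N H).arithmeticSubgroup) :
            (cmDatum L N H).Adelic)} : Set (cmDatum L N H).Adelic))
          (fun _ hg => Subgroup.mem_centralizer_singleton_iff.1 hg) Φ y‖ ∂(μC c)) ∧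
        ∫ x, quotientKernel (cmDatum L N H).quotientSubgroup ρ Φ x x ∂μ =
          ((κ : ℝ) : ℂ) * ∑' c, ((dc c).toReal : ℂ) * ∫ y, descConj
            ((Quotient.out c : (cmDatum L N H).arithmeticSubgroup) : (cmDatum L N H).Adelic)
            (Subgroup.centralizer ({((Quotient.out c : (cmDatum L N H).arithmeticSubgroup) :
              (cmDatum L N H).Adelic)} : Set (cmDatum L N H).Adelic))
            (fun _ hg => Subgroup.mem_centralizer_singleton_iff.1 hg) Φ y ∂(μC c) := by
  haveI := compactSpace_cmDatum_automorphicQuotient L N H hanis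
  exact (cmDatum L N H).integral_quotientKernel_diag_eq_mul_tsum_of_center'_eq_bot
    (cmDatum_center' L N H) (cmDatum_isDiscreteRational L N H) μ ρ

/-- **The simple trace formula for `U(H)`, `H` anisotropic, in Hilbert–Schmidt form**: combining
the geometric side (`integral_quotientKernel_diag_eq_mul_tsum_cmDatum`) with the spectral side
`Σ_i ‖R(f) e_i‖² = c⁻¹ ∫_X K_{f ⋆ f^*}(x, x) dμ` of the tree
(`AdelicGroupData.hasSum_norm_sq_integratedOperator_rightRegular_eq_diagonal`; Gelbart (1975),
(9.11) and Lemma 10.6: `tr R(f ⋆ f^*) = ∫ K_{f⋆f^*}(x, x)`): for `μ` automorphic, `ρ` a Haar measure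
on the discrete `U(H)(L⁺)`, `ν` a Haar measure on `U(H)(𝔸_{L⁺})` (unimodular,
`isMulRightInvariant_cmDatum`), there are `κ > 0`, `d_c ∈ (0, ∞)`, non-zero invariant measures `μ_c`
on `U(H)(𝔸) ⧸ U(H)(𝔸)_{γ_c}` such that for every `f ∈ C_c(U(H)(𝔸))` and every countable Hilbert
basis `(e_i)` of `L²(X, μ)`: the orbital integrals of `f ⋆ f^*` converge absolutely and

  `Σ_i ‖R(f) e_i‖² = c⁻¹ · κ · Σ'_c d_c ∫ (f ⋆ f^*)(y γ_c y⁻¹) dμ_c(y)`,  `c = unfoldingConstant`.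

This is the concrete `J_{G′}`-side `Σ_{γ} a_γ O_γ(f′ ⋆ f′^*)` of Rogawski's identity
`tr ρ(f′) = J_{G′}(f′)` for the anisotropic inner form [§14.5 p. 237 (print)], in the currency of the
floor-0 line (Hilbert–Schmidt norms, no trace class). CAVEAT: `a_γ = c⁻¹ κ d_c · (normalisation of μ_c)`
is not identified with a Tamagawa volume. [cite: Rogawski1990, §14.5 p. 237] -/
theorem hasSum_norm_sq_integratedOperator_eq_tsum_orbital_cmDatum
    (hanis : ∀ x : Fin N → L, hermForm (cmConjRingHom L) H x x = 0 → x = 0)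
    [hH : IsClosed ((cmDatum L N H).quotientSubgroup : Set (cmDatum L N H).Adelic)]
    (μ : Measure (cmDatum L N H).automorphicQuotient) [(cmDatum L N H).IsAutomorphicMeasure μ]
    (ρ : Measure (cmDatum L N H).quotientSubgroup) [ρ.IsHaarMeasure] [SFinite ρ]
    (ν : Measure (cmDatum L N H).Adelic) [ν.IsHaarMeasure] :
    ∃ (κ : ℝ≥0) (dc : ConjClasses (cmDatum L N H).arithmeticSubgroup → ℝ≥0∞)
      (μC : ∀ c : ConjClasses (cmDatum L N H).arithmeticSubgroup, Measure ((cmDatum L N H).Adelic ⧸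
        Subgroup.centralizer ({((Quotient.out c : (cmDatum L N H).arithmeticSubgroup) :
          (cmDatum L N H).Adelic)} : Set (cmDatum L N H).Adelic))),
      0 < κ ∧ (∀ c, dc c ≠ 0 ∧ dc c ≠ ∞) ∧
      (∀ c, SMulInvariantMeasure (cmDatum L N H).Adelic _ (μC c) ∧
        IsFiniteMeasureOnCompacts (μC c) ∧ μC c ≠ 0) ∧
      ∀ (f : C_c((cmDatum L N H).Adelic, ℂ)) {ι : Type*} [Countable ι]
        (b : HilbertBasis ι ℂ ((cmDatum L N H).L2 μ)),
        (∀ c, Integrable (descConj ((Quotient.out c : (cmDatum L N H).arithmeticSubgroup) :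
            (cmDatum L N H).Adelic)
          (Subgroup.centralizer ({((Quotient.out c : (cmDatum L N H).arithmeticSubgroup) :
            (cmDatum L N H).Adelic)} : Set (cmDatum L N H).Adelic))
          (fun _ hg => Subgroup.mem_centralizer_singleton_iff.1 hg)
          (mulConv ν (⇑f) (mulStar (⇑f)))) (μC c)) ∧
        HasSum (fun i => ((‖((cmDatum L N H).rightRegular μ).integratedOperator
            ((cmDatum L N H).isUnitary_rightRegular μ)
            ((cmDatum L N H).isStronglyContinuous_rightRegular_holds μ) ν f (b i)‖ ^ 2 : ℝ) : ℂ))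
          (((unfoldingConstant (cmDatum L N H).quotientSubgroup ρ μ ν : ℝ)⁻¹ : ℂ) *
            (((κ : ℝ) : ℂ) * ∑' c, ((dc c).toReal : ℂ) * ∫ y, descConj
              ((Quotient.out c : (cmDatum L N H).arithmeticSubgroup) : (cmDatum L N H).Adelic)
              (Subgroup.centralizer ({((Quotient.out c : (cmDatum L N H).arithmeticSubgroup) :
                (cmDatum L N H).Adelic)} : Set (cmDatum L N H).Adelic))
              (fun _ hg => Subgroup.mem_centralizer_singleton_iff.1 hg)
              (mulConv ν (⇑f) (mulStar (⇑f))) y ∂(μC c))) := by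
  haveI := compactSpace_cmDatum_automorphicQuotient L N H hanis
  have hdisc := cmDatum_isDiscreteRational L N H
  haveI : DiscreteTopology (cmDatum L N H).arithmeticSubgroup := hdisc
  -- `ρ` and `ν` are two-sided and inversion invariant (discrete group; unimodular `U(H)(𝔸)`)
  obtain ⟨hθc, hθA, hθa, hθγ⟩ :=
    AdelicGroupData.centralRetraction_one (cmDatum L N H) (cmDatum_center' L N H)
  haveI : ρ.IsMulRightInvariant :=
    AdelicGroupData.isMulRightInvariant_of_centralRetraction (cmDatum L N H) hdisc 1 hθc hθA hθa
      hθγ ρ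
  haveI : LocallyCompactSpace (cmDatum L N H).quotientSubgroup :=
    hH.isClosedEmbedding_subtypeVal.locallyCompactSpace
  haveI : SecondCountableTopology (cmDatum L N H).quotientSubgroup :=
    TopologicalSpace.Subtype.secondCountableTopology _
  haveI : ρ.IsInvInvariant := isInvInvariant_of_isMulRightInvariant ρ
  haveI : ν.IsMulRightInvariant := isMulRightInvariant_cmDatum L N H hanis ν
  haveI : ν.IsInvInvariant := isInvInvariant_of_isMulRightInvariant ν
  have hρ0 : ρ ≠ 0 := fun h => by
    have h2 : 0 < ρ Set.univ := isOpen_univ.measure_pos ρ ⟨1, trivial⟩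
    rw [h] at h2
    exact lt_irrefl _ h2
  obtain ⟨κ, dc, μC, hκ, hdc, hμC, hΦ⟩ :=
    integral_quotientKernel_diag_eq_mul_tsum_cmDatum L N H hanis μ ρ
  refine ⟨κ, dc, μC, hκ, hdc, hμC, fun f ι _ b => ?_⟩
  -- `f ⋆ f^* ∈ C_c`
  obtain ⟨F, hF⟩ : ∃ F : C_c((cmDatum L N H).Adelic, ℂ),
      (⇑F : (cmDatum L N H).Adelic → ℂ) = mulConv ν (⇑f) (mulStar (⇑f)) :=
    ⟨⟨⟨mulConv ν (⇑f) (mulStar (⇑f)), continuous_mulConv ν f.continuous f.hasCompactSupport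
      (continuous_mulStar f.continuous)⟩,
      hasCompactSupport_mulConv ν f.hasCompactSupport (hasCompactSupport_mulStar f.hasCompactSupport)⟩,
      rfl⟩
  obtain ⟨hInt, -, hEq⟩ := hΦ F
  have hHS := AdelicGroupData.hasSum_norm_sq_integratedOperator_rightRegular_eq_diagonal
    (cmDatum L N H) μ ρ ν hρ0 f b
  rw [← hF, hEq] at hHS
  rw [← hF]
  exact ⟨hInt, hHS⟩

/-- **The same identity with ONE positive constant and no auxiliary choices in the statement** —
the form a consumer typed over the line's data `(μ, ν)` uses without the kernel's quotient-form
instances: for `H` anisotropic, `μ` automorphic and `ν` a Haar measure on `U(H)(𝔸_{L⁺})` there are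
`C > 0`, `d_c ∈ (0, ∞)` and non-zero invariant measures `μ_c` on `U(H)(𝔸) ⧸ U(H)(𝔸)_{γ_c}` such
that for every `f ∈ C_c(U(H)(𝔸))` and every countable Hilbert basis `(e_i)` of `L²(X, μ)` the
orbital integrals of `f ⋆ f^*` converge absolutely, `Σ_c d_c O_{γ_c}(|f ⋆ f^*|) < ∞`, and

  `Σ_i ‖R(f) e_i‖² = C · Σ'_c d_c ∫ (f ⋆ f^*)(y γ_c y⁻¹) dμ_c(y)`

(`C = c⁻¹ κ` of `hasSum_norm_sq_integratedOperator_eq_tsum_orbital_cmDatum` for the Haar measure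
`ρ = haar` of the discrete `U(H)(L⁺)`; Rogawski (1990), §14.5 p. 237 (print): `tr ρ(f′) = Σ_γ a_γ Φ_γ(f′)`
for the anisotropic `G′`, here in Hilbert–Schmidt form). CAVEAT: `C`, `d_c`, `μ_c` not normalised.
[cite: Rogawski1990, §14.5 p. 237] -/
theorem hasSum_norm_sq_integratedOperator_eq_const_mul_tsum_orbital_cmDatum
    (hanis : ∀ x : Fin N → L, hermForm (cmConjRingHom L) H x x = 0 → x = 0)
    (μ : Measure (cmDatum L N H).automorphicQuotient) [(cmDatum L N H).IsAutomorphicMeasure μ]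
    (ν : Measure (cmDatum L N H).Adelic) [ν.IsHaarMeasure] :
    ∃ (C : ℝ≥0) (dc : ConjClasses (cmDatum L N H).arithmeticSubgroup → ℝ≥0∞)
      (μC : ∀ c : ConjClasses (cmDatum L N H).arithmeticSubgroup, Measure ((cmDatum L N H).Adelic ⧸
        Subgroup.centralizer ({((Quotient.out c : (cmDatum L N H).arithmeticSubgroup) :
          (cmDatum L N H).Adelic)} : Set (cmDatum L N H).Adelic))),
      0 < C ∧ (∀ c, dc c ≠ 0 ∧ dc c ≠ ∞) ∧
      (∀ c, SMulInvariantMeasure (cmDatum L N H).Adelic _ (μC c) ∧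
        IsFiniteMeasureOnCompacts (μC c) ∧ μC c ≠ 0) ∧
      ∀ (f : C_c((cmDatum L N H).Adelic, ℂ)) {ι : Type*} [Countable ι]
        (b : HilbertBasis ι ℂ ((cmDatum L N H).L2 μ)),
        (∀ c, Integrable (descConj ((Quotient.out c : (cmDatum L N H).arithmeticSubgroup) :
            (cmDatum L N H).Adelic)
          (Subgroup.centralizer ({((Quotient.out c : (cmDatum L N H).arithmeticSubgroup) :
            (cmDatum L N H).Adelic)} : Set (cmDatum L N H).Adelic))
          (fun _ hg => Subgroup.mem_centralizer_singleton_iff.1 hg)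
          (mulConv ν (⇑f) (mulStar (⇑f)))) (μC c)) ∧
        Summable (fun c => (dc c).toReal * ∫ y, ‖descConj
          ((Quotient.out c : (cmDatum L N H).arithmeticSubgroup) : (cmDatum L N H).Adelic)
          (Subgroup.centralizer ({((Quotient.out c : (cmDatum L N H).arithmeticSubgroup) :
            (cmDatum L N H).Adelic)} : Set (cmDatum L N H).Adelic))
          (fun _ hg => Subgroup.mem_centralizer_singleton_iff.1 hg)
          (mulConv ν (⇑f) (mulStar (⇑f))) y‖ ∂(μC c)) ∧
        HasSum (fun i => ((‖((cmDatum L N H).rightRegular μ).integratedOperator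
            ((cmDatum L N H).isUnitary_rightRegular μ)
            ((cmDatum L N H).isStronglyContinuous_rightRegular_holds μ) ν f (b i)‖ ^ 2 : ℝ) : ℂ))
          (((C : ℝ) : ℂ) * ∑' c, ((dc c).toReal : ℂ) * ∫ y, descConj
              ((Quotient.out c : (cmDatum L N H).arithmeticSubgroup) : (cmDatum L N H).Adelic)
              (Subgroup.centralizer ({((Quotient.out c : (cmDatum L N H).arithmeticSubgroup) :
                (cmDatum L N H).Adelic)} : Set (cmDatum L N H).Adelic))
              (fun _ hg => Subgroup.mem_centralizer_singleton_iff.1 hg)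
              (mulConv ν (⇑f) (mulStar (⇑f))) y ∂(μC c)) := by
  haveI := compactSpace_cmDatum_automorphicQuotient L N H hanis
  have hdisc := cmDatum_isDiscreteRational L N H
  haveI : DiscreteTopology (cmDatum L N H).arithmeticSubgroup := hdisc
  obtain ⟨hθc, hθA, hθa, hθγ⟩ :=
    AdelicGroupData.centralRetraction_one (cmDatum L N H) (cmDatum_center' L N H)
  haveI hH : IsClosed ((cmDatum L N H).quotientSubgroup : Set (cmDatum L N H).Adelic) :=
    AdelicGroupData.isClosed_quotientSubgroup_of_centralRetraction (cmDatum L N H) hdisc 1 hθc hθA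
      hθa hθγ
  haveI : LocallyCompactSpace (cmDatum L N H).quotientSubgroup :=
    hH.isClosedEmbedding_subtypeVal.locallyCompactSpace
  haveI : SecondCountableTopology (cmDatum L N H).quotientSubgroup :=
    TopologicalSpace.Subtype.secondCountableTopology _
  -- the Haar measure `ρ` of the discrete `U(H)(L⁺)`
  haveI : (haar : Measure (cmDatum L N H).quotientSubgroup).IsMulRightInvariant :=
    AdelicGroupData.isMulRightInvariant_of_centralRetraction (cmDatum L N H) hdisc 1 hθc hθA hθa
      hθγ haar
  haveI : (haar : Measure (cmDatum L N H).quotientSubgroup).IsInvInvariant :=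
    isInvInvariant_of_isMulRightInvariant haar
  haveI : ν.IsMulRightInvariant := isMulRightInvariant_cmDatum L N H hanis ν
  haveI : ν.IsInvInvariant := isInvInvariant_of_isMulRightInvariant ν
  have hρ0 : (haar : Measure (cmDatum L N H).quotientSubgroup) ≠ 0 := fun h => by
    have h2 : 0 < (haar : Measure (cmDatum L N H).quotientSubgroup) Set.univ :=
      isOpen_univ.measure_pos haar ⟨1, trivial⟩
    rw [h] at h2
    exact lt_irrefl _ h2
  obtain ⟨κ, dc, μC, hκ, hdc, hμC, hΦ⟩ :=
    integral_quotientKernel_diag_eq_mul_tsum_cmDatum L N H hanis μ haar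
  have hcpos : 0 < unfoldingConstant (cmDatum L N H).quotientSubgroup haar μ ν :=
    unfoldingConstant_pos (cmDatum L N H).quotientSubgroup haar μ ν
      (AdelicGroupData.IsAutomorphicMeasure.ne_zero (cmDatum L N H) μ) hρ0
  refine ⟨(unfoldingConstant (cmDatum L N H).quotientSubgroup haar μ ν)⁻¹ * κ, dc, μC,
    mul_pos (inv_pos.2 hcpos) hκ, hdc, hμC, fun f ι _ b => ?_⟩
  -- `f ⋆ f^* ∈ C_c`
  obtain ⟨F, hF⟩ : ∃ F : C_c((cmDatum L N H).Adelic, ℂ),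
      (⇑F : (cmDatum L N H).Adelic → ℂ) = mulConv ν (⇑f) (mulStar (⇑f)) :=
    ⟨⟨⟨mulConv ν (⇑f) (mulStar (⇑f)), continuous_mulConv ν f.continuous f.hasCompactSupport
      (continuous_mulStar f.continuous)⟩,
      hasCompactSupport_mulConv ν f.hasCompactSupport (hasCompactSupport_mulStar f.hasCompactSupport)⟩,
      rfl⟩
  obtain ⟨hInt, hSum, hEq⟩ := hΦ F
  have hHS := AdelicGroupData.hasSum_norm_sq_integratedOperator_rightRegular_eq_diagonal
    (cmDatum L N H) μ haar ν hρ0 f b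
  rw [← hF, hEq, ← mul_assoc] at hHS
  rw [← hF]
  refine ⟨hInt, hSum, ?_⟩
  have hC : ((((unfoldingConstant (cmDatum L N H).quotientSubgroup haar μ ν)⁻¹ * κ : ℝ≥0) : ℝ) : ℂ) =
      (((unfoldingConstant (cmDatum L N H).quotientSubgroup haar μ ν : ℝ)⁻¹ : ℂ)) * ((κ : ℝ) : ℂ) := by
    push_cast
    ring
  rw [hC]
  exact hHS

end UnitaryGroup

end Literature.NumberTheory.Automorphic
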